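import Mathlib
import Summits.ResolutionOfSingularities.ResolutionOfSingularities.Theorems.WeightedInvariantLocalWeightedDropWildMonicFlagDropShear
import Summits.ResolutionOfSingularities.ResolutionOfSingularities.Theorems.WeightedInvariantLocalWeightedDropWildPurePowerFlagDropZeroShape

/-!
# `WeightedInvariant.LocalWeightedDrop`, line `hasse-ridge-face-selection`, S3ρ: Uk-ρD1 (b) — the child-flag type N0-FIRST from the
# canonical `n = 0` package (Per17 Prop 9.1.4 case (1) in game form)

Crux item stmt-ResolutionOfSingularities-8899 `LocalWeightedDrop` (route `ResolutionOfSingularities/WeightedInvariant`), engine of the door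
`HypersurfaceCentreConstruction` stmt-ResolutionOfSingularities-19897.  [OURS · L1 W4.3, chain w43, res-type-083 (S3ρ first seat, (C9) lead;
OFFER 09:41:18Z to res-D-pv-005 AS stub-7, who keeps Uk-ρD1 (a) `AxisPackageN0`).  MAP: S. Perlega, arXiv:2011.14443 Prop 9.1.4 proof
case (1) p0105: «Assume that `n_G = 0` and `t = 0` … we can replace `y` by `y + x h(x)` … we may assume that `h = 0` … `d_G ≤ d_{F′} ≤ d_F`.
If `d_{F′} < d_F` … Using Prop (cleaning_transversal_flags) (3) … `inv(G) ≤ inv(F′)` … `inv(F′) < inv(F)` if `s_F < ∞` … So assume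
`s_F = ∞`»; every object OURS; not a statement of any manuscript.]

`dropAxisN0First_of_package : AxisPackageN0 d p k → DropAxisN0First d p k`.
* `h = 0` (`dropAxisN0First_zero_of_package`): for a valid first-orientation child flag `G = (g, 0)`: `d_G ≤ d_{F′} ≤ d_F` by (iii), (iv);
  `d_G < d_F` ⇒ the parent flag `F = (g₀, 0)` dominates strictly in the first component; `d_G = d_F` ⇒ `d` kept, `s_G ≤ s_{F′}` by (vii),
  and `s_{F′} < s_F` or `s_F = ⊤` by (vi) — `FirstDominates` by `F`.
* `h ≠ 0` (so `V(x₂)` is not a boundary letter): the SHEARED axis step `(A ∘ shear_{x·h}, T ∘ shear_h, φ′ ∘ shear_h)` (`isAxisStep_shear`,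
  `…WildMonicFlagDropShear`) has child `C ∘ shear_h`, whose flag `(g, 0)` IS the flag `(g, h)` of `C` (same numbers); the `h = 0` case there
  yields a dominator `(g₀, h₀)` of `A ∘ shear_{x·h}`, i.e. the flag `(g₀, x·h + h₀)` of `A` (stub-3's `flagTuple_flagTuple`), with the same
  numbers (`V(x₂)` not boundary ⇒ all first-orientation flags are `n = 0` flags).
-/

set_option linter.dupNamespace false -- mandated namespace of this single-conjunct summit

noncomputable section

namespace Summit.ResolutionOfSingularities.ResolutionOfSingularities.Theorems

open Literature.AlgebraicGeometry.Resolution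
open Literature.AlgebraicGeometry.Resolution.HauserPerlega2024 (Triple)

namespace WildMonic

open MvPowerSeries MonicDescent
open PurePowerFlag (swap swapE orient orientE IsN0 IsTangent succE)

variable {k : Type} [Field k] {d : ℕ}

/-- **Uk-ρD1 (b), the case `h = 0`**: a valid first-orientation `n = 0` child flag `(g, 0)` of a charged axis step is dominated by the
package's parent flag `F = (g₀, 0)` — strictly, or weakly with `s_F = ⊤`. -/
theorem dropAxisN0First_zero_of_package {p : ℕ} (hpkg : AxisPackageN0 d p k) (A : Fin d → MvPowerSeries (Fin 2) k) (E : Finset (Fin 2))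
    (T : Fin d → MvPowerSeries (Fin 2) k) (φ' : MvPowerSeries (Fin 2) k) (hstep : IsAxisStep d p A T φ')
    (g : MvPowerSeries (Fin 2) k) (hg : constantCoeff g = 0) (hmm : IsMMax d (shift d T φ') (succE (0 : k) E) g 0) :
    FirstDominates d A E (flagTriple d (shift d T φ') (succE (0 : k) E) g 0) := by
  obtain ⟨g₀, g₀', hg₀, hg₀', hmax₀, -, hdmax, hdle, -, hsdrop, hsmax⟩ := hpkg A E T φ' hstep
  set dG := dRes (succE (0 : k) E) (newtonSet (flagTuple d (shift d T φ') g 0)) with hdG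
  set sG := sValue d.factorial (succE (0 : k) E) (newtonSet (flagTuple d (shift d T φ') g 0)) with hsG
  set d' := dRes (succE (0 : k) E) (newtonSet (flagTuple d (shift d T φ') g₀' 0)) with hd'
  set s' := sValue d.factorial (succE (0 : k) E) (newtonSet (flagTuple d (shift d T φ') g₀' 0)) with hs'
  set dP := dRes E (newtonSet (flagTuple d A g₀ 0)) with hdP
  set sP := sValue d.factorial E (newtonSet (flagTuple d A g₀ 0)) with hsP
  have hvG : flagTriple d (shift d T φ') (succE (0 : k) E) g 0 = toLex (dG, toLex (0, sG)) := flagTriple_zero_eq _ _ _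
  have hvP : flagTriple d A E g₀ 0 = toLex (dP, toLex (0, sP)) := flagTriple_zero_eq _ _ _
  have hdGd' : dG ≤ d' := hdmax g hg hmm
  have hdG_le : dG ≤ dP := hdGd'.trans hdle
  refine ⟨g₀, 0, hg₀, map_zero _, Or.inl (Or.inr rfl : IsN0 E (0 : PowerSeries k)), hmax₀, ?_⟩
  rw [hvG, hvP]
  rcases hdG_le.lt_or_eq with hlt | heq
  · -- `d` dropped: strict in the first component
    have h : toLex (dG, toLex ((0 : ℕ), sG)) < toLex (dP, toLex ((0 : ℕ), sP)) := Prod.Lex.toLex_lt_toLex.mpr (Or.inl hlt)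
    exact ⟨h.le, Or.inl h⟩
  · -- `d` kept
    have hkept : d' = dP := le_antisymm hdle (heq ▸ hdGd')
    have hdG' : dG = d' := le_antisymm hdGd' (hkept.trans heq.symm).le
    have hsG_le : sG ≤ s' := hsmax g hg hmm hdG'
    rcases hsdrop hkept with hslt | hstop
    · have h : toLex (dG, toLex ((0 : ℕ), sG)) < toLex (dP, toLex ((0 : ℕ), sP)) :=
        Prod.Lex.toLex_lt_toLex.mpr (Or.inr ⟨heq, Prod.Lex.toLex_lt_toLex.mpr (Or.inr ⟨rfl, hsG_le.trans_lt hslt⟩)⟩)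
      exact ⟨h.le, Or.inl h⟩
    · refine ⟨Prod.Lex.toLex_le_toLex.mpr (Or.inr ⟨heq, Prod.Lex.toLex_le_toLex.mpr (Or.inr ⟨rfl, ?_⟩)⟩), Or.inr hstop⟩
      rw [hstop]; exact le_top

/-- The sheared parent as a flag tuple: `A ∘ shear_{H} = flagTuple d A 0 H`. -/
theorem shear_eq_flagTuple (A : Fin d → MvPowerSeries (Fin 2) k) (H : PowerSeries k) :
    (fun j => subst (PurePowerFlag.shift H) (A j)) = flagTuple d A 0 H := by
  rw [flagTuple_def, WildMonic.shift_zero]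

/-- FLAGS OF THE SHEARED PARENT ARE FLAGS OF THE PARENT: `flagTuple d (A ∘ shear_H) g₀ h₀ = flagTuple d A g₀ (H + h₀)`. -/
theorem flagTuple_shear_parent_add (A : Fin d → MvPowerSeries (Fin 2) k) (g₀ : MvPowerSeries (Fin 2) k) {H h₀ : PowerSeries k}
    (hH : PowerSeries.constantCoeff H = 0) (hh₀ : PowerSeries.constantCoeff h₀ = 0) :
    flagTuple d (fun j => subst (PurePowerFlag.shift H) (A j)) g₀ h₀ = flagTuple d A g₀ (H + h₀) := by
  have hs : HasSubst (PurePowerFlag.shift h₀) := PurePowerFlag.hasSubst_shift' h₀ hh₀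
  rw [shear_eq_flagTuple, flagTuple_flagTuple A 0 g₀ hH hh₀, ← coe_substAlgHom hs, map_zero, zero_add]

/-- **Uk-ρD1 (b): `DropAxisN0First` FROM THE CANONICAL `n = 0` PACKAGE** (Per17 Prop 9.1.4 case (1) in game form). -/
theorem dropAxisN0First_of_package {p : ℕ} (hpkg : AxisPackageN0 d p k) : DropAxisN0First d p k := by
  intro A E T φ' hstep g h hg hh hn hmm
  by_cases h0 : h = 0
  · subst h0
    exact dropAxisN0First_zero_of_package hpkg A E T φ' hstep g hg hmm
  -- `h ≠ 0`: the old letter is not boundary, neither for the child nor for the parent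
  have h1E' : (1 : Fin 2) ∉ succE (0 : k) E := by
    rcases hn with h1 | h0'
    · exact h1
    · exact absurd h0' h0
  have h1E : (1 : Fin 2) ∉ E := fun h1 => h1E' ((PurePowerFlag.one_mem_succE_zero_iff E).mpr h1)
  -- the sheared step and its child
  have hstep₁ := isAxisStep_shear hstep hh
  set A₁ : Fin d → MvPowerSeries (Fin 2) k := fun j => subst (PurePowerFlag.shift (PowerSeries.X * h)) (A j) with hA₁
  set T₁ : Fin d → MvPowerSeries (Fin 2) k := fun j => subst (PurePowerFlag.shift h) (T j) with hT₁
  set φ₁ : MvPowerSeries (Fin 2) k := subst (PurePowerFlag.shift h) φ' with hφ₁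
  have hC₁ : (fun j => subst (PurePowerFlag.shift h) (shift d T φ' j)) = shift d T₁ φ₁ := (shift_shear hh T φ').symm
  have hflag : ∀ g' : MvPowerSeries (Fin 2) k, flagTuple d (shift d T φ') g' h = flagTuple d (shift d T₁ φ₁) g' 0 := fun g' => by
    rw [flagTuple_shear_child, hC₁]
  have hmOf : ∀ g' : MvPowerSeries (Fin 2) k, mOf d (shift d T φ') (succE (0 : k) E) g' h = mOf d (shift d T₁ φ₁) (succE (0 : k) E) g' 0 :=
    fun g' => by rw [mOf_of_isN0 (Or.inl h1E'), mOf_of_isN0 (Or.inr rfl), hflag]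
  have hmm₁ : IsMMax d (shift d T₁ φ₁) (succE (0 : k) E) g 0 := fun g' hg' => by rw [← hmOf, ← hmOf]; exact hmm g' hg'
  have htri : flagTriple d (shift d T φ') (succE (0 : k) E) g h = flagTriple d (shift d T₁ φ₁) (succE (0 : k) E) g 0 := by
    rw [flagTriple_of_isN0 (Or.inl h1E'), flagTriple_of_isN0 (Or.inr rfl), hflag]
  -- the `h = 0` case for the sheared step
  obtain ⟨g₀, h₀, hg₀, hh₀, -, hmax₀, hle, hor⟩ := dropAxisN0First_zero_of_package hpkg A₁ E T₁ φ₁ hstep₁ g hg hmm₁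
  -- transfer the dominator `(g₀, h₀)` of `A ∘ shear_{x·h}` to the flag `(g₀, x·h + h₀)` of `A`
  have hXh := constantCoeff_X_mul h
  have hflagP : ∀ g' : MvPowerSeries (Fin 2) k, flagTuple d A₁ g' h₀ = flagTuple d A g' (PowerSeries.X * h + h₀) :=
    fun g' => flagTuple_shear_parent_add A g' hXh hh₀
  have hsum0 : PowerSeries.constantCoeff (PowerSeries.X * h + h₀) = 0 := by rw [map_add, hXh, hh₀, add_zero]
  have hmOfP : ∀ g' : MvPowerSeries (Fin 2) k, mOf d A₁ E g' h₀ = mOf d A E g' (PowerSeries.X * h + h₀) := fun g' => by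
    rw [mOf_of_isN0 (Or.inl h1E), mOf_of_isN0 (Or.inl h1E), hflagP]
  have hmaxP : IsMMax d A E g₀ (PowerSeries.X * h + h₀) := fun g' hg' => by rw [← hmOfP, ← hmOfP]; exact hmax₀ g' hg'
  have htriP : flagTriple d A₁ E g₀ h₀ = flagTriple d A E g₀ (PowerSeries.X * h + h₀) := by
    rw [flagTriple_of_isN0 (Or.inl h1E), flagTriple_of_isN0 (Or.inl h1E), hflagP]
  refine ⟨g₀, PowerSeries.X * h + h₀, hg₀, hsum0, Or.inl (Or.inl h1E), hmaxP, ?_, ?_⟩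
  · rw [htri, ← htriP]; exact hle
  · rw [htri, ← htriP]; exact hor

end WildMonic

end Summit.ResolutionOfSingularities.ResolutionOfSingularities.Theorems

end
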